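import Literature.RingTheory.FormalGroups.CocyclePolynomial
import Mathlib.Algebra.Field.ZMod
import HarnessLib

/-!
# Lazard's symmetric 2-cocycle lemma, I: coefficients in a vector space over `𝔽_ℓ`
# ([Lazard 1955] §II Lemme 3; [Hazewinkel 1978] §5.2–5.3)

Topic `Literature/RingTheory/FormalGroups`; namespace `Literature.RingTheory.FormalGroups`.  Fully proved theorems; no
definition, no named fact, no instance, no notation, no `sorry`.  Cell `hodgecm-mathlib`, P6 «MOD programme», sub-line P6d.

THE LEMMA (Lazard's «lemme 3», the comparison lemma behind the structure of the Lazard ring and of Drinfeld's `Λ_𝒪`): a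
symmetric 2-cocycle `Γ(X,Y)` of degree `n ≥ 1` — `Γ(X,Y) = Γ(Y,X)`, `Γ(Y,Z) + Γ(X,Y+Z) = Γ(X+Y,Z) + Γ(X,Y)` — is a multiple of
`C_n(X,Y) = ((X+Y)^n − X^n − Y^n)/ν(n)`.  This file proves it for coefficients in any module `V` over `ZMod ℓ` (`ℓ` prime), in the
coefficient form `IsSymmCocycle n a` of the sibling `CocyclePolynomial`:

* `IsSymmCocycle.eq_zero_of_apply_one` — VANISHING CRITERION: a cocycle with `a 1 = 0` and (when `ℓ ∣ n`, `n ≠ ℓ`) vanishing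
  `ℓ`-divisible coefficients `a (ℓ·m')` is zero (Lazard's relation `m·a m = (n−1 choose m−1)·a 1` and symmetry).
* `IsSymmCocycle.restrictMul` — for `ℓ ∣ n`, `m' ↦ a (ℓ·m')` is a symmetric 2-cocycle of degree `n/ℓ` (Lucas's theorem
  `(ℓx choose ℓy) ≡ (x choose y)`).
* `IsSymmCocycle.apply_one_eq_zero_of_dvd` — for `ℓ ∣ n ≠ ℓ`, `a 1 = 0` automatically (`(n−1 choose ℓ−1) ≡ 1`).
* `IsSymmCocycle.exists_eq_cocycleCoeff_smul_zmod` (coefficients in `ZMod ℓ`) and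
  `IsSymmCocycle.exists_eq_cocycleCoeff_smul_of_module_zmod` (coefficients in any `ZMod ℓ`-module): `∃ t, a = C_n • t`,
  by strong induction on `n` — subtract the right multiple of `C_n` and apply the vanishing criterion; in the case `ℓ ∣ n ≠ ℓ` the
  multiple is read off the restriction to `ℓ`-divisible indices, the comparison scalar `κ` (restriction of `C_n` versus
  `C_{n/ℓ}`) being NONZERO by primitivity of `C_n`.

Deliberately NOT here: arbitrary coefficient groups (sibling `SymmetricCocycle`), power series.
-/

namespace Literature.RingTheory.FormalGroups

open Finset

section Module

variable {ℓ : ℕ} {V : Type*} [AddCommGroup V] [Module (ZMod ℓ) V] [hℓ : Fact ℓ.Prime] {n : ℕ} {a : ℕ → V}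

omit hℓ in
/-- In a `ZMod ℓ`-module, `c • v = 0` when `ℓ ∣ c`. [folklore] -/
private theorem nsmul_eq_zero_of_dvd {c : ℕ} (hc : ℓ ∣ c) (v : V) : c • v = 0 := by
  rw [← Nat.cast_smul_eq_nsmul (ZMod ℓ), (ZMod.natCast_eq_zero_iff c ℓ).2 hc, zero_smul]

omit hℓ in
/-- In a `ZMod ℓ`-module, `c • v = d • v` when `c ≡ d (mod ℓ)`. [folklore] -/
private theorem nsmul_congr_of_modEq {c d : ℕ} (h : c ≡ d [MOD ℓ]) (v : V) : c • v = d • v := by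
  rw [← Nat.cast_smul_eq_nsmul (ZMod ℓ), ← Nat.cast_smul_eq_nsmul (ZMod ℓ) d, (ZMod.natCast_eq_natCast_iff _ _ _).2 h]

/-- In a `ZMod ℓ`-module, `m • v = 0` with `ℓ ∤ m` forces `v = 0`. [folklore] -/
private theorem eq_zero_of_nsmul_eq_zero {m : ℕ} (hm : ¬ ℓ ∣ m) {v : V} (h : m • v = 0) : v = 0 := by
  have hm' : (m : ZMod ℓ) ≠ 0 := by rwa [Ne, ZMod.natCast_eq_zero_iff]
  rw [← Nat.cast_smul_eq_nsmul (ZMod ℓ)] at h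
  have h' := congrArg ((m : ZMod ℓ)⁻¹ • ·) h
  have e : (m : ZMod ℓ)⁻¹ * (m : ZMod ℓ) = 1 := ZMod.inv_mul_of_unit _ (IsUnit.mk0 (m : ZMod ℓ) hm')
  simpa [smul_smul, e] using h'

/-- **Vanishing criterion.**  A symmetric 2-cocycle of degree `n ≥ 1` with coefficients in a `ZMod ℓ`-module, with `a 1 = 0`
and — in case `ℓ ∣ n`, `n ≠ ℓ` — with `a (ℓ·m') = 0` for all `m'`, vanishes identically: for `ℓ ∤ m` Lazard's relation
`m·a m = (n−1 choose m−1)·a 1` gives `a m = 0`, for `ℓ ∤ n − m` symmetry does, and `ℓ ∣ m, ℓ ∣ n−m` is the excluded case.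
[cite: Lazard1955, §II Lemme 3] -/
theorem IsSymmCocycle.eq_zero_of_apply_one (ha : IsSymmCocycle n a) (hn : 0 < n) (h1 : a 1 = 0)
    (hdiv : ℓ ∣ n → n ≠ ℓ → ∀ m', a (ℓ * m') = 0) (m : ℕ) : a m = 0 := by
  have key : ∀ m, 0 < m → m < n → ¬ ℓ ∣ m → a m = 0 := fun m hm0 hmn hℓm => by
    apply eq_zero_of_nsmul_eq_zero hℓm
    rw [ha.self_smul_eq hm0 hmn, h1, smul_zero]
  rcases Nat.lt_or_ge n m with hnm | hmn
  · exact ha.eq_zero_of_lt m hnm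
  rcases hmn.eq_or_lt with rfl | hmn
  · exact ha.apply_self hn.ne'
  rcases Nat.eq_zero_or_pos m with rfl | hm0
  · exact ha.apply_zero hn.ne'
  by_cases hℓm : ℓ ∣ m
  · by_cases hℓm' : ℓ ∣ n - m
    · have hℓn : ℓ ∣ n := by
        have := Nat.dvd_add hℓm hℓm'
        rwa [Nat.add_sub_cancel' hmn.le] at this
      by_cases hnℓ : n = ℓ
      · exfalso
        subst hnℓ
        exact absurd (Nat.le_of_dvd hm0 hℓm) (not_le.2 hmn)
      · obtain ⟨m', rfl⟩ := hℓm
        exact hdiv hℓn hnℓ m'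
    · rw [← ha.symm m hmn.le]
      exact key (n - m) (by omega) (by omega) hℓm'
  · exact key m hm0 hmn hℓm

/-- **Restriction to `ℓ`-divisible indices.**  For `ℓ ∣ n`, `m' ↦ a (ℓ·m')` is a symmetric 2-cocycle of degree `n/ℓ`
(coefficients in a `ZMod ℓ`-module): the relations at `(ℓi', ℓj', ℓk')` reduce by Lucas's theorem
`(ℓx choose ℓy) ≡ (x choose y) (mod ℓ)`. [cite: Lazard1955, §II Lemme 3] -/
theorem IsSymmCocycle.restrictMul (ha : IsSymmCocycle n a) (hℓn : ℓ ∣ n) :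
    IsSymmCocycle (n / ℓ) (fun m' => a (ℓ * m')) := by
  obtain ⟨n', rfl⟩ := hℓn
  have hℓ0 : 0 < ℓ := hℓ.out.pos
  rw [Nat.mul_div_cancel_left n' hℓ0]
  refine ⟨fun m' hm' => ha.eq_zero_of_lt _ (Nat.mul_lt_mul_left hℓ0 |>.2 hm'), fun m' hm' => ?_, fun i j k h => ?_⟩
  · have := ha.symm (ℓ * m') (Nat.mul_le_mul_left ℓ hm')
    rwa [← Nat.mul_sub] at this
  · have hrel := ha.cocycle (ℓ * i) (ℓ * j) (ℓ * k) (by rw [← mul_add, ← mul_add, h])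
    have e1 : (ℓ * i = 0) = (i = 0) := by simp [hℓ0.ne']
    have e2 : (ℓ * k = 0) = (k = 0) := by simp [hℓ0.ne']
    simp only [e1, e2, ← mul_add] at hrel
    rwa [nsmul_congr_of_modEq (Choose.choose_mul_mul_modEq_choose_nat (p := ℓ) (a := j + k) (b := j)),
      nsmul_congr_of_modEq (Choose.choose_mul_mul_modEq_choose_nat (p := ℓ) (a := i + j) (b := i))] at hrel

/-- Lucas at `(ℓn' − 1, ℓ − 1)`: `(ℓ·n' − 1 choose ℓ − 1) ≡ 1 (mod ℓ)` for `n' ≥ 1` (base-`ℓ` digits `(n'−1; ℓ−1)` over `(0; ℓ−1)`).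
[folklore] -/
private theorem choose_mul_sub_one_modEq_one {n' : ℕ} (hn' : 0 < n') : (ℓ * n' - 1).choose (ℓ - 1) ≡ 1 [MOD ℓ] := by
  have hℓ1 : 1 ≤ ℓ := hℓ.out.one_lt.le
  obtain ⟨n'', rfl⟩ := Nat.exists_eq_add_of_le' hn'
  have e : ℓ * (n'' + 1) - 1 = (ℓ - 1) + ℓ * n'' := by
    rw [mul_add, mul_one]; omega
  rw [e]
  have h := Choose.choose_modEq_choose_mod_mul_choose_div_nat (p := ℓ) (n := (ℓ - 1) + ℓ * n'') (k := ℓ - 1)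
  have hmod : (ℓ - 1) % ℓ = ℓ - 1 := Nat.mod_eq_of_lt (by omega)
  rw [Nat.add_mul_mod_self_left, hmod, Nat.add_mul_div_left _ _ hℓ.out.pos, Nat.div_eq_of_lt (by omega : ℓ - 1 < ℓ),
    zero_add, Nat.choose_self, Nat.choose_zero_right, mul_one] at h
  exact h

/-- **`a 1 = 0` when `ℓ ∣ n ≠ ℓ`** (coefficients in a `ZMod ℓ`-module): the inner relation at `(1, ℓ−1, n−ℓ)` reads
`(n−1 choose ℓ−1)·a 1 = ℓ·a ℓ = 0` and `(n−1 choose ℓ−1) ≡ 1 (mod ℓ)`. [cite: Lazard1955, §II Lemme 3] -/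
theorem IsSymmCocycle.apply_one_eq_zero_of_dvd (ha : IsSymmCocycle n a) (hn : 0 < n) (hℓn : ℓ ∣ n) (hnℓ : n ≠ ℓ) :
    a 1 = 0 := by
  obtain ⟨n', rfl⟩ := hℓn
  have hℓ2 : 2 ≤ ℓ := hℓ.out.two_le
  have hn'0 : 0 < n' := Nat.pos_of_mul_pos_left hn
  have hn'1 : n' ≠ 1 := fun h => hnℓ (by rw [h, mul_one])
  have hn'2 : 2 ≤ n' := by omega
  have hle : ℓ * 2 ≤ ℓ * n' := Nat.mul_le_mul_left ℓ hn'2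
  have h := ha.choose_smul_eq (i := 1) (j := ℓ - 1) (k := ℓ * n' - ℓ) (by omega) one_ne_zero (by omega)
  rw [show ℓ - 1 + (ℓ * n' - ℓ) = ℓ * n' - 1 by omega, show 1 + (ℓ - 1) = ℓ by omega, Nat.choose_one_right,
    nsmul_congr_of_modEq (choose_mul_sub_one_modEq_one hn'0), one_smul, nsmul_eq_zero_of_dvd (dvd_refl ℓ) (a ℓ)] at h
  exact h

end Module

/-! ## The lemma over `ZMod ℓ` and over `ZMod ℓ`-modules -/

section Main

variable {ℓ : ℕ} {V : Type*} [AddCommGroup V] [Module (ZMod ℓ) V]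

/-- `C_n` with coefficients read in `ZMod ℓ` is a symmetric 2-cocycle. [cite: Lazard1955, §II Lemme 3] -/
private theorem isSymmCocycle_cocycleCoeff_cast (n : ℕ) :
    IsSymmCocycle n (fun m => (cocycleCoeff n m : ZMod ℓ)) :=
  (isSymmCocycle_cocycleCoeff n).map (Nat.castAddMonoidHom (ZMod ℓ))

variable [hℓ : Fact ℓ.Prime]

/-- **Induction step of the symmetric 2-cocycle lemma** (coefficients in a `ZMod ℓ`-module `V`), from the lemma in all
degrees `< n` for coefficients in `ZMod ℓ` itself (the comparison scalar) and in `V`. [cite: Lazard1955, §II Lemme 3] -/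
theorem IsSymmCocycle.exists_eq_cocycleCoeff_smul_step {n : ℕ} (hn : 0 < n)
    (hK : ∀ n' < n, 0 < n' → ∀ b : ℕ → ZMod ℓ, IsSymmCocycle n' b → ∃ κ : ZMod ℓ, ∀ m, b m = cocycleCoeff n' m • κ)
    (hV : ∀ n' < n, 0 < n' → ∀ b : ℕ → V, IsSymmCocycle n' b → ∃ t : V, ∀ m, b m = cocycleCoeff n' m • t)
    {a : ℕ → V} (ha : IsSymmCocycle n a) : ∃ t : V, ∀ m, a m = cocycleCoeff n m • t := by
  have hℓp := hℓ.out
  -- degree 1: everything vanishes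
  rcases Nat.lt_or_ge 1 n with hn2 | hn1
  swap
  · obtain rfl : n = 1 := le_antisymm hn1 hn
    refine ⟨0, fun m => ?_⟩
    rw [smul_zero]
    exact ha.eq_zero_of_apply_one hn (ha.apply_self one_ne_zero)
      (fun hℓn _ => (hℓp.one_lt.ne' (Nat.dvd_one.1 hℓn)).elim) m
  -- the generic device: subtract `C_n • s` and apply the vanishing criterion
  have reduce : ∀ s : V, a 1 = cocycleCoeff n 1 • s →
      (ℓ ∣ n → n ≠ ℓ → ∀ m', a (ℓ * m') = cocycleCoeff n (ℓ * m') • s) → ∀ m, a m = cocycleCoeff n m • s := by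
    intro s h1 hdiv m
    have hsub := ha.sub (isSymmCocycle_cocycleCoeff_smul n s)
    have h1' : a 1 - cocycleCoeff n 1 • s = 0 := by rw [h1, sub_self]
    have hdiv' : ℓ ∣ n → n ≠ ℓ → ∀ m', a (ℓ * m') - cocycleCoeff n (ℓ * m') • s = 0 := fun hℓn hnℓ m' => by
      rw [hdiv hℓn hnℓ m', sub_self]
    exact sub_eq_zero.1 (hsub.eq_zero_of_apply_one hn h1' hdiv' m)
  by_cases hcase : ℓ ∣ n ∧ n ≠ ℓ
  · -- case `ℓ ∣ n ≠ ℓ`: read the scalar off the restriction to `ℓ`-divisible indices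
    obtain ⟨hℓn, hnℓ⟩ := hcase
    have hn' : 0 < n / ℓ := Nat.div_pos (Nat.le_of_dvd hn hℓn) hℓp.pos
    have hn'n : n / ℓ < n := Nat.div_lt_self hn hℓp.one_lt
    obtain ⟨t, ht⟩ := hV (n / ℓ) hn'n hn' _ (ha.restrictMul hℓn)
    obtain ⟨κ, hκ⟩ := hK (n / ℓ) hn'n hn' _ ((isSymmCocycle_cocycleCoeff_cast n).restrictMul hℓn)
    have hc1 : (cocycleCoeff n 1 : ZMod ℓ) = 0 := by
      have := (isSymmCocycle_cocycleCoeff_cast (ℓ := ℓ) n).apply_one_eq_zero_of_dvd hn hℓn hnℓ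
      exact this
    have hκ0 : κ ≠ 0 := by
      intro hκ0
      have hzero : ∀ m, (cocycleCoeff n m : ZMod ℓ) = 0 :=
        (isSymmCocycle_cocycleCoeff_cast n).eq_zero_of_apply_one hn hc1 (fun _ _ m' => by rw [hκ m', hκ0, smul_zero])
      have hn2' : 2 ≤ n := hn2
      obtain ⟨m, -, -, hndvd⟩ := exists_not_dvd_cocycleCoeff hn2' hℓp
      exact hndvd ((ZMod.natCast_eq_zero_iff _ _).1 (hzero m))
    refine ⟨κ⁻¹ • t, reduce _ ?_ fun _ _ m' => ?_⟩
    · rw [ha.apply_one_eq_zero_of_dvd hn hℓn hnℓ, ← Nat.cast_smul_eq_nsmul (ZMod ℓ), hc1, zero_smul]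
    · rw [ht m', ← Nat.cast_smul_eq_nsmul (ZMod ℓ), ← Nat.cast_smul_eq_nsmul (ZMod ℓ) (cocycleCoeff n _), hκ m',
        nsmul_eq_mul, smul_smul]
      have e : κ * κ⁻¹ = 1 := ZMod.mul_inv_of_unit _ (IsUnit.mk0 κ hκ0)
      rw [mul_assoc, e, mul_one]
  · -- case `ℓ ∤ n` or `n = ℓ`: read the scalar off `a 1`
    have hc1 : (cocycleCoeff n 1 : ZMod ℓ) ≠ 0 := by
      rw [Ne, ZMod.natCast_eq_zero_iff]
      intro hdvd
      have hmul := lazardNu_mul_cocycleCoeff Nat.one_pos (show 1 < n from hn2)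
      rw [Nat.choose_one_right] at hmul
      have hℓn : ℓ ∣ n := hmul ▸ dvd_mul_of_dvd_right hdvd _
      have hnℓ : n = ℓ := by
        by_contra h
        exact hcase ⟨hℓn, h⟩
      subst hnℓ
      rw [cocycleCoeff_prime_one hℓp] at hdvd
      exact hℓp.one_lt.ne' (Nat.dvd_one.1 hdvd)
    refine ⟨(cocycleCoeff n 1 : ZMod ℓ)⁻¹ • a 1, reduce _ ?_ fun hℓn hnℓ => absurd ⟨hℓn, hnℓ⟩ hcase⟩
    have e : (cocycleCoeff n 1 : ZMod ℓ) * (cocycleCoeff n 1 : ZMod ℓ)⁻¹ = 1 :=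
      ZMod.mul_inv_of_unit _ (IsUnit.mk0 (cocycleCoeff n 1 : ZMod ℓ) hc1)
    rw [← Nat.cast_smul_eq_nsmul (ZMod ℓ), smul_smul, e, one_smul]

/-- **Lazard's symmetric 2-cocycle lemma, coefficients in `ZMod ℓ`**: every symmetric 2-cocycle of degree `n ≥ 1` is
`C_n · t`. [cite: Lazard1955, §II Lemme 3] [cite: Hazewinkel1978, §5.3] -/
theorem IsSymmCocycle.exists_eq_cocycleCoeff_smul_zmod {n : ℕ} (hn : 0 < n) {a : ℕ → ZMod ℓ} (ha : IsSymmCocycle n a) :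
    ∃ t : ZMod ℓ, ∀ m, a m = cocycleCoeff n m • t := by
  induction n using Nat.strong_induction_on generalizing a with
  | _ n ih =>
    exact ha.exists_eq_cocycleCoeff_smul_step (ℓ := ℓ) hn (fun n' h h0 b hb => ih n' h h0 hb)
      (fun n' h h0 b hb => ih n' h h0 hb)

end Main

/-- **Lazard's symmetric 2-cocycle lemma, coefficients in a `ZMod ℓ`-module** (`ℓ` prime; e.g. an abelian group killed by
`ℓ`): every symmetric 2-cocycle of degree `n ≥ 1` is `C_n • t` for some `t`. [cite: Lazard1955, §II Lemme 3] [cite: Hazewinkel1978, §5.3] -/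
theorem IsSymmCocycle.exists_eq_cocycleCoeff_smul_of_module_zmod (ℓ : ℕ) [Fact ℓ.Prime] {V : Type*} [AddCommGroup V]
    [Module (ZMod ℓ) V] {n : ℕ} (hn : 0 < n) {a : ℕ → V}
    (ha : IsSymmCocycle n a) : ∃ t : V, ∀ m, a m = cocycleCoeff n m • t := by
  induction n using Nat.strong_induction_on generalizing a with
  | _ n ih =>
    exact ha.exists_eq_cocycleCoeff_smul_step (ℓ := ℓ) hn (fun n' _ h0 b hb => hb.exists_eq_cocycleCoeff_smul_zmod h0)
      (fun n' h h0 b hb => ih n' h h0 hb)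


end Literature.RingTheory.FormalGroups
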